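import Mathlib.Data.Matrix.Basic
import Mathlib.Data.Matrix.Mul
import Mathlib.Data.Matrix.Diagonal
import Mathlib.Algebra.BigOperators.Group.Finset.Basic
import Mathlib.Tactic.Ring
import Mathlib.Tactic.Abel
import HarnessLib

/-!
# Solo (blind) programme — the base point `λ = -1`: the abelian torsor computation (kernel of hodge.md §8.10, D.19)

Pure matrix algebra over a commutative ring / field; no periods, no Hodge theory, no statement about the
Kontsevich–Zagier conjecture is made or used here.

Context (paper level only, `HOME/paper/hodge.md` §8.10).  For the polylogarithm cube germ at the base point
`λ = -1` the normalised period matrix is the classical matrix at `ℓ = log(-1) = iπ`; all its entries are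
rational except the row-`0` entries at odd columns (`ζ(p)/(2πi)^p ∈ iℝ ∖ 0`).  The Mumford–Tate group is then
caught between a rational conjugate of `D ⋉ (1 + 𝔞)`, `𝔞 = ⊕_{p odd} ℚ E_{0p}`, and the torsor condition; the
decisive step is a computation in the VECTOR GROUP `1 + {row-0 nilpotents}`:
`(1 + A c) · χ(t) · (1 + A c)⁻¹ · χ(t)⁻¹ = 1 + A (p ↦ c_p (1 - t_0 t_p⁻¹))`, so membership in `1 + 𝔲′` with
`𝔲′ ⊂ 𝔞` missing the slot `p` forces `c_p = 0` as soon as the weights of slot `0` and slot `p` differ.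
This file checks exactly these identities (`torsor_conj`, `rigidity`) and the bookkeeping
`(γ (1 + A c))_{0p} = γ_{0p} + c_p` for `γ₀₀ = 1` (`gamma_mul_oneAdd_apply`).
-/

namespace Summit.KontsevichZagierPeriods.KontsevichZagierPeriods.Theorems

namespace SoloBlind

namespace PolylogMinusOne

open Matrix

variable {K : Type*} [CommRing K] {n : ℕ}

/-- `A c = Σ_{p ≠ 0} c_p E_{0p}`: the row-`0` nilpotent with coefficients `c` (the value `c 0` is ignored). -/
def A (c : Fin (n + 2) → K) : Matrix (Fin (n + 2)) (Fin (n + 2)) K :=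
  fun i j => if i = 0 ∧ j ≠ 0 then c j else 0

/-- Entries of `A c`. -/
theorem A_apply (c : Fin (n + 2) → K) (i j : Fin (n + 2)) :
    A c i j = if i = 0 ∧ j ≠ 0 then c j else 0 := rfl

/-- `A` is additive in the coefficients. -/
theorem A_add (c d : Fin (n + 2) → K) : A (c + d) = A c + A d := by
  ext i j
  simp only [A_apply, Matrix.add_apply, Pi.add_apply]
  split_ifs <;> simp

/-- Two coefficient vectors agreeing off `0` give the same matrix. -/
theorem A_congr {c d : Fin (n + 2) → K} (h : ∀ p, p ≠ 0 → c p = d p) : A c = A d := by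
  ext i j
  simp only [A_apply]
  split_ifs with hij
  · exact h j hij.2
  · rfl

/-- Row-`0` nilpotents multiply to zero: `A c * A d = 0` (no `E_{0p}`, `p ≠ 0`, starts in column `0`). -/
theorem A_mul_A (c d : Fin (n + 2) → K) : A c * A d = 0 := by
  ext i j
  rw [Matrix.mul_apply, Matrix.zero_apply]
  apply Finset.sum_eq_zero
  intro l _
  simp only [A_apply]
  by_cases hl : l = 0
  · subst hl; simp
  · simp [hl]

/-- The vector group law: `(1 + A c)(1 + A d) = 1 + A (c + d)`. -/
theorem oneAdd_mul_oneAdd (c d : Fin (n + 2) → K) :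
    (1 + A c) * (1 + A d) = 1 + A (c + d) := by
  rw [Matrix.add_mul, Matrix.mul_add, Matrix.mul_add, Matrix.one_mul, Matrix.mul_one, Matrix.one_mul,
    A_mul_A, A_add]
  abel

/-- In particular `1 + A (-c)` is the inverse of `1 + A c`. -/
theorem oneAdd_mul_oneAdd_neg (c : Fin (n + 2) → K) : (1 + A c) * (1 + A (-c)) = 1 := by
  rw [oneAdd_mul_oneAdd, add_neg_cancel]
  have : A (0 : Fin (n + 2) → K) = 0 := by
    ext i j; simp [A_apply]
  rw [this, add_zero]

/-- Diagonal conjugation rescales the coefficients: `diag(w) · A c · diag(w') = A (p ↦ w₀ c_p w'_p)`. -/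
theorem diag_mul_A_mul_diag (w w' : Fin (n + 2) → K) (c : Fin (n + 2) → K) :
    Matrix.diagonal w * A c * Matrix.diagonal w' = A (fun p => w 0 * c p * w' p) := by
  ext i j
  rw [Matrix.mul_diagonal, Matrix.diagonal_mul]
  simp only [A_apply]
  split_ifs with h
  · rw [h.1]
  · simp

/-- THE TORSOR COMPUTATION.  With `χ = diag(w)`, `χ⁻¹ = diag(w')` (`w_i w'_i = 1`):
`(1 + A c) χ (1 + A c)⁻¹ χ⁻¹ = 1 + A (p ↦ c_p (1 - w₀ w'_p))`. -/
theorem torsor_conj (w w' : Fin (n + 2) → K) (hw : ∀ i, w i * w' i = 1) (c : Fin (n + 2) → K) :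
    (1 + A c) * Matrix.diagonal w * (1 + A (-c)) * Matrix.diagonal w'
      = 1 + A (fun p => c p * (1 - w 0 * w' p)) := by
  have hd : Matrix.diagonal w * Matrix.diagonal w' = (1 : Matrix (Fin (n + 2)) (Fin (n + 2)) K) := by
    rw [Matrix.diagonal_mul_diagonal]
    have : (fun i => w i * w' i) = fun _ => (1 : K) := funext hw
    rw [this, Matrix.diagonal_one]
  have h1 : (1 + A c) * Matrix.diagonal w * (1 + A (-c)) * Matrix.diagonal w'
      = (1 + A c) * (Matrix.diagonal w * (1 + A (-c)) * Matrix.diagonal w') := by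
    simp only [Matrix.mul_assoc]
  have h2 : Matrix.diagonal w * (1 + A (-c)) * Matrix.diagonal w'
      = 1 + A (fun p => w 0 * (-c) p * w' p) := by
    rw [Matrix.mul_add, Matrix.mul_one, Matrix.add_mul, hd, diag_mul_A_mul_diag]
  rw [h1, h2, oneAdd_mul_oneAdd]
  congr 1
  apply A_congr
  intro p _
  simp only [Pi.add_apply, Pi.neg_apply]
  ring

/-- Entry `(0,p)`, `p ≠ 0`, of `1 + A f` is `f p`. -/
theorem oneAdd_A_apply (f : Fin (n + 2) → K) (p : Fin (n + 2)) (hp : p ≠ 0) :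
    (1 + A f) 0 p = f p := by
  rw [Matrix.add_apply, Matrix.one_apply_ne (Ne.symm hp), A_apply]
  simp [hp]

/-- Bookkeeping for the upper bound: if `γ₀₀ = 1` then `(γ (1 + A c))_{0p} = γ_{0p} + c_p` (`p ≠ 0`):
replacing the odd row-`0` entries of the period matrix by `0` gives a factorisation `Π = γ₀ (1 + A c)`. -/
theorem gamma_mul_oneAdd_apply (γ : Matrix (Fin (n + 2)) (Fin (n + 2)) K) (hγ : γ 0 0 = 1)
    (c : Fin (n + 2) → K) (p : Fin (n + 2)) (hp : p ≠ 0) :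
    (γ * (1 + A c)) 0 p = γ 0 p + c p := by
  rw [Matrix.mul_add, Matrix.mul_one, Matrix.add_apply, Matrix.mul_apply]
  congr 1
  rw [Finset.sum_eq_single (0 : Fin (n + 2))]
  · rw [hγ, one_mul, A_apply]; simp [hp]
  · intro l _ hl
    rw [A_apply]; simp [hl]
  · intro h; exact absurd (Finset.mem_univ _) h

/-- RIGIDITY (the decisive step of D.19).  Over a field: if the torsor element `1 + A c` conjugates the
cocharacter value `χ = diag(w)` into `1 + A f` with `f` vanishing at a slot `p ≠ 0` whose weight differs
from that of slot `0` (`w₀ w'_p ≠ 1`), then `c_p = 0` — i.e. the corresponding period-matrix entry is the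
RATIONAL number it was shifted by.  In §8.10 this contradicts `Π_{0p} ∈ iℝ ∖ 0` for odd `p`. -/
theorem rigidity {F : Type*} [Field F] {n : ℕ} (w w' : Fin (n + 2) → F) (hw : ∀ i, w i * w' i = 1)
    (c f : Fin (n + 2) → F)
    (hT : (1 + A c) * Matrix.diagonal w * (1 + A (-c)) * Matrix.diagonal w' = 1 + A f)
    (p : Fin (n + 2)) (hp : p ≠ 0) (hf : f p = 0) (hwp : w 0 * w' p ≠ 1) : c p = 0 := by
  rw [torsor_conj w w' hw c] at hT
  have h : ((1 : Matrix (Fin (n + 2)) (Fin (n + 2)) F) + A (fun p => c p * (1 - w 0 * w' p))) 0 p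
      = (1 + A f) 0 p := by rw [hT]
  rw [oneAdd_A_apply _ p hp, oneAdd_A_apply _ p hp, hf] at h
  rcases mul_eq_zero.mp h with h0 | h1
  · exact h0
  · exact absurd (sub_eq_zero.mp h1).symm hwp

/-- All slots at once: under the torsor identity, `c` vanishes at every slot `p ≠ 0` off the support of `f`
whose weight differs from slot `0`'s. -/
theorem rigidity_all {F : Type*} [Field F] {n : ℕ} (w w' : Fin (n + 2) → F) (hw : ∀ i, w i * w' i = 1)
    (c f : Fin (n + 2) → F)
    (hT : (1 + A c) * Matrix.diagonal w * (1 + A (-c)) * Matrix.diagonal w' = 1 + A f)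
    (hwt : ∀ p : Fin (n + 2), p ≠ 0 → w 0 * w' p ≠ 1) :
    ∀ p : Fin (n + 2), p ≠ 0 → f p = 0 → c p = 0 :=
  fun p hp hf => rigidity w w' hw c f hT p hp hf (hwt p hp)

end PolylogMinusOne

end SoloBlind

end Summit.KontsevichZagierPeriods.KontsevichZagierPeriods.Theorems
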